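import Mathlib
import Summits.KontsevichZagierPeriods.KontsevichZagierPeriods.Theses.SymplecticScissors
import Summits.KontsevichZagierPeriods.KontsevichZagierPeriods.Theses.SphericalSchlafli
import Summits.KontsevichZagierPeriods.KontsevichZagierPeriods.Theses.WeightFloor
import Literature.NumberTheory.Transcendental.KZCalculusProofs
import Literature.NumberTheory.Transcendental.KZVolumeConjectureProofs
import Summits.KontsevichZagierPeriods.KontsevichZagierPeriods.Theorems.SymplecticScissorsVolumeFormStackReduction
import Summits.KontsevichZagierPeriods.KontsevichZagierPeriods.Theorems.SymplecticScissorsVolumeFormStackSector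
import Summits.KontsevichZagierPeriods.KontsevichZagierPeriods.Theorems.SymplecticScissorsVolumeFormOddBallCylinder
import Summits.KontsevichZagierPeriods.KontsevichZagierPeriods.Theorems.SymplecticScissorsVolumeFormConeThird
import Summits.KontsevichZagierPeriods.KontsevichZagierPeriods.Theorems.SymplecticScissorsVolumeFormSolidHatBox
import Summits.KontsevichZagierPeriods.KontsevichZagierPeriods.Theorems.SymplecticScissorsVolumeFormPerspectiveMap

/-!
# `VolumeForm` (stmt-KontsevichZagierPeriods-3814, routes SymplecticScissors r0 / SphericalSchlafli r0 /
# WeightFloor r0) — line `Sketch` (card `ruled-stacks-archimedes`), lead skeleton v3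

The crux (the FRAME, summit-equivalent): for every `N`, two integrand-`1` representations of
dimension `N` — two `ℚ`-semialgebraic sets of finite volume — with the same value are KZ-equivalent.

Line (crux idea card `Cruxes/VolumeForm/Ideas/ruled-stacks-archimedes.md`, ideator-1 sketch
`Cruxes/VolumeForm/SketchIdeator1.lean`): RULED STACKS AND ARCHIMEDEAN FLATTENINGS — the sector `𝒮` of
3-dimensional solids that collapse, by explicit rule-2 / rule-3 moves with `|det| = 1` and polynomial
primitives, onto PLANAR integrand-`1` sets, so that on `𝒮` the frame follows from the planar layer
`PlanarAreas` (stmt-4990, Huber–Wüstholz strength, its own line), and an honest remainder.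

## State after waves 1–2 (v3, 2026-08-16)

LANDED (all `--supports stmt-KontsevichZagierPeriods-3814`, axioms standard; wave-1 files imported above, wave-2 files
imported in the full copy `work/VolumeForm.v3full.lean` once the farm has rebuilt them), the line's
SECTOR `𝒮` decided by the planar layer `PlanarAreas` (stmt-4990):
* wave 1: `stub_stackReduction` (triangular stack ≡ planar subgraph of `|det M(t)|/2`; p91145),
  `stub_stackSector` (p88759), `stub_oddBallCylinder` (p89262), `stub_coneThird` (p89799), `stub_solidHatBox`
  (p91439), `stub_perspectiveMap` (all-`N` radial shadow; p89618);
* wave 2: `stub_subgraphStacking` (k planar subgraphs stack into one; p92998), `stub_stackUnionReduction`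
  (finite disjoint unions of stacks = ruled stacks with polygonal sections ≡ one planar subgraph; p92948),
  `stub_stackUnionSector` (p92648), `stub_coneFlatten` (all-`n` cones ≡ squeezed bases; p93431),
  `stub_coneSector` (cones in `ℝ³` over planar sets, given `PlanarAreas`; p92701), `stub_oddBallEven`
  (B^{2m+3} → B^{2m+2} × (−c, c), one move; p93143).

RESHAPE v3 (lead): the UNCONDITIONAL sub-sector. Inside `𝒮` the planar layer is itself provable whenever the
slice-area function has a `ℚ`-semialgebraic PRIMITIVE — one more Newton–Leibniz move lands in dimension
ZERO, where equal values are equal constants. New stubs: `stub_primitiveSubgraphToPoint` (planar subgraph of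
`f ≥ 0` with semialgebraic primitive `F` on a rational interval ≡ the point representation with constant
`F b − F a`), `stub_polyStackHeight` (a finite disjoint union of POLYNOMIAL triangular stacks ≡ the planar
subgraph of a non-negative `ℚ`-polynomial), `stub_polyStackUnconditional` (two such unions of equal volume are
KZ-equivalent — NO `PlanarAreas`, no transcendence input: Hilbert's third problem has no Dehn obstruction in
the KZ calculus for polynomial ruled solids, in particular for rational polytopes after slicing; the polytope
sector of Cresson–Viu-Sos 2022 §4 by a two-move Fubini argument). The remainder `stub_offPlanarKernel`
(frame modulo equal-area planar pairs, crux-strength, certified) is unchanged.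

Composition (sorry-free): `VolumeForm_of (hP : PlanarAreas) : VolumeForm` — reduce both sets to bounded ones
(tree theorem `KZ.exists_isBounded_sub_mem_relations`), apply `stub_offPlanarKernel`, and kill every
planar-pair generator by `PlanarAreas`. The sector theorems are what the line PROVES; the remainder is what it
cannot (certified crux-equivalent: `offPlanarKernel_of_volumeForm`).

Stub signatures are written in tree vocabulary only (no local definitions), so that each lands verbatim as
`Theorems/SymplecticScissorsVolumeForm<Stub>.lean --supports stmt-KontsevichZagierPeriods-3814`.

References: M. Kontsevich, D. Zagier, *Periods* (2001), §1.1 (`π` as an area), §1.2 (rules (1)–(3));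
J. Cresson, J. Viu-Sos, *On the equality of periods of Kontsevich–Zagier* (2022), §4 (polytope sector);
Archimedes, *On the Sphere and Cylinder* I, *Method* (cone = cylinder / 3);
A. Huber, G. Wüstholz, *Transcendence and Linear Relations of 1-Periods* (2022), Thm 13.3 (enters only
through stmt-4990 / stmt-10042).
-/

noncomputable section

open scoped BigOperators
open Set MeasureTheory
open Literature.NumberTheory.Transcendental

namespace Summit.KontsevichZagierPeriods.SymplecticScissors.VolumeForm

open Summit.KontsevichZagierPeriods.KontsevichZagierPeriods.Theses.SymplecticScissors (VolumeForm PlanarAreas)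

/-! ## Open stubs (v3): the unconditional sub-sector -/

/-- **Semialgebraic primitives land in dimension zero** (size M/L). If `f ≥ 0` on a rational interval
`(a, b)` has a `ℚ`-semialgebraic primitive `F` (continuous on `[a, b]`, `F' = f` inside), then the
integrand-`1` planar representation on the open subgraph of `f` is KZ-equivalent to the POINT representation
(dimension `0`, domain the one-point space) with constant integrand `F b − F a`, which exists (the constant is
a real algebraic number: values of a `ℚ`-semialgebraic function at rational points,
`Literature/NumberTheory/Transcendental/SemialgebraicAlgebraicPoints.lean`). Moves: a null modification to
the closed band, `KZ.exists_underGraph` in reverse (rule 3, primitive `σ`) down to `[[a,b], f]`, and ONE more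
Newton–Leibniz move with base dimension `0` and primitive `F` (rule 3 verbatim: `∫ₐᵇ F' = F b − F a`). This is
the step the primitive-elimination barrier (`Literature.Barriers.KontsevichZagierPeriods.noSemialgebraicPrimitive_inv_sub_two`)
forbids in general and allows exactly here. -/
theorem stub_primitiveSubgraphToPoint : ∀ (a b : ℚ) (f F : ℝ → ℝ) (s : KZ.IntegralRep 2),
    a < b →
    IsSemialgebraicFunOn ℚ {z : Fin 1 → ℝ | z 0 ∈ Set.Ioo (a : ℝ) b} (fun z => f (z 0)) →
    IsSemialgebraicFunOn ℚ {z : Fin 1 → ℝ | z 0 ∈ Set.Icc (a : ℝ) b} (fun z => F (z 0)) →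
    ContinuousOn F (Set.Icc (a : ℝ) b) →
    (∀ t ∈ Set.Ioo (a : ℝ) b, HasDerivAt F (f t) t) →
    (∀ t ∈ Set.Ioo (a : ℝ) b, 0 ≤ f t) →
    s.domain = {q | q 0 ∈ Set.Ioo (a : ℝ) b ∧ 0 < q 1 ∧ q 1 < f (q 0)} →
    (∀ q ∈ s.domain, s.integrand q = 1) →
    ∃ c : KZ.IntegralRep 0, c.domain = Set.univ ∧ (∀ x, c.integrand x = F b - F a) ∧ KZ.Equivalent s c := by
  sorry

/-- **Polynomial ruled stacks have polynomial slice-area** (size M/L). A finite disjoint union of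
triangular stacks whose vertex curves are `ℚ`-POLYNOMIALS over a rational parameter interval is
KZ-equivalent to the integrand-`1` planar representation under the graph of a non-negative `ℚ`-polynomial
`Q` (namely `∑ᵢ εᵢ Dᵢ / 2`, `εᵢ = sign Dᵢ` constant on `(a, b)`), which exists: the landed
`stub_stackUnionReduction ∘ stub_subgraphStacking` (polynomial maps are semialgebraic and `C¹`) followed by
the sign dichotomy for each non-vanishing continuous `Dᵢ` on the connected interval. -/
theorem stub_polyStackHeight : ∀ (k : ℕ) (a b : ℚ) (P : Fin k → Fin 3 → Fin 2 → Polynomial ℚ) (r : KZ.IntegralRep 3),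
    a < b →
    (∀ i, ∀ t ∈ Set.Ioo (a : ℝ) b,
        (Polynomial.aeval t (P i 1 0) - Polynomial.aeval t (P i 0 0)) *
          (Polynomial.aeval t (P i 2 1) - Polynomial.aeval t (P i 0 1)) -
        (Polynomial.aeval t (P i 1 1) - Polynomial.aeval t (P i 0 1)) *
          (Polynomial.aeval t (P i 2 0) - Polynomial.aeval t (P i 0 0)) ≠ 0) →
    (∀ i i', i ≠ i' → Disjoint
      {p : Fin 3 → ℝ | p 0 ∈ Set.Ioo (a : ℝ) b ∧ ∃ l m : ℝ, 0 < l ∧ 0 < m ∧ l + m < 1 ∧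
          p 1 = Polynomial.aeval (p 0) (P i 0 0) + l * (Polynomial.aeval (p 0) (P i 1 0) - Polynomial.aeval (p 0) (P i 0 0)) +
            m * (Polynomial.aeval (p 0) (P i 2 0) - Polynomial.aeval (p 0) (P i 0 0)) ∧
          p 2 = Polynomial.aeval (p 0) (P i 0 1) + l * (Polynomial.aeval (p 0) (P i 1 1) - Polynomial.aeval (p 0) (P i 0 1)) +
            m * (Polynomial.aeval (p 0) (P i 2 1) - Polynomial.aeval (p 0) (P i 0 1))}
      {p : Fin 3 → ℝ | p 0 ∈ Set.Ioo (a : ℝ) b ∧ ∃ l m : ℝ, 0 < l ∧ 0 < m ∧ l + m < 1 ∧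
          p 1 = Polynomial.aeval (p 0) (P i' 0 0) + l * (Polynomial.aeval (p 0) (P i' 1 0) - Polynomial.aeval (p 0) (P i' 0 0)) +
            m * (Polynomial.aeval (p 0) (P i' 2 0) - Polynomial.aeval (p 0) (P i' 0 0)) ∧
          p 2 = Polynomial.aeval (p 0) (P i' 0 1) + l * (Polynomial.aeval (p 0) (P i' 1 1) - Polynomial.aeval (p 0) (P i' 0 1)) +
            m * (Polynomial.aeval (p 0) (P i' 2 1) - Polynomial.aeval (p 0) (P i' 0 1))}) →
    r.domain = ⋃ i, {p : Fin 3 → ℝ | p 0 ∈ Set.Ioo (a : ℝ) b ∧ ∃ l m : ℝ, 0 < l ∧ 0 < m ∧ l + m < 1 ∧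
          p 1 = Polynomial.aeval (p 0) (P i 0 0) + l * (Polynomial.aeval (p 0) (P i 1 0) - Polynomial.aeval (p 0) (P i 0 0)) +
            m * (Polynomial.aeval (p 0) (P i 2 0) - Polynomial.aeval (p 0) (P i 0 0)) ∧
          p 2 = Polynomial.aeval (p 0) (P i 0 1) + l * (Polynomial.aeval (p 0) (P i 1 1) - Polynomial.aeval (p 0) (P i 0 1)) +
            m * (Polynomial.aeval (p 0) (P i 2 1) - Polynomial.aeval (p 0) (P i 0 1))} →
    (∀ p ∈ r.domain, r.integrand p = 1) →
    ∃ (Q : Polynomial ℚ) (s : KZ.IntegralRep 2),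
      (∀ t ∈ Set.Ioo (a : ℝ) b, 0 ≤ Polynomial.aeval t Q) ∧
      s.domain = {q | q 0 ∈ Set.Ioo (a : ℝ) b ∧ 0 < q 1 ∧ q 1 < Polynomial.aeval (q 0) Q} ∧
      (∀ q ∈ s.domain, s.integrand q = 1) ∧ KZ.Equivalent r s := by
  sorry

/-- **Hilbert's third problem has no obstruction in the calculus for polynomial ruled solids** (glue,
size M/L; UNCONDITIONAL — no `PlanarAreas`, no transcendence input). Given `stub_primitiveSubgraphToPoint` and
`stub_polyStackHeight`, two finite disjoint unions of polynomial triangular stacks (rational coefficients and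
parameter intervals; e.g. rational polytopes after slicing and fan-triangulating their sections) with equal
volume are KZ-equivalent: both collapse to point representations (antiderivative of a `ℚ`-polynomial,
`Polynomial.hasDerivAt_aeval`), whose constants are their common value, and two point representations with
the same constant differ by a relation (`KZ.of_sub_of_mem_relations_of_eqOn`). The polytope sector of
[Cresson–Viu-Sos 2022, §4] inside the calculus, by two Fubini moves instead of Henriques–Pak maps. -/
theorem stub_polyStackUnconditional :
    (∀ (a b : ℚ) (f F : ℝ → ℝ) (s : KZ.IntegralRep 2),
      a < b →
      IsSemialgebraicFunOn ℚ {z : Fin 1 → ℝ | z 0 ∈ Set.Ioo (a : ℝ) b} (fun z => f (z 0)) →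
      IsSemialgebraicFunOn ℚ {z : Fin 1 → ℝ | z 0 ∈ Set.Icc (a : ℝ) b} (fun z => F (z 0)) →
      ContinuousOn F (Set.Icc (a : ℝ) b) →
      (∀ t ∈ Set.Ioo (a : ℝ) b, HasDerivAt F (f t) t) →
      (∀ t ∈ Set.Ioo (a : ℝ) b, 0 ≤ f t) →
      s.domain = {q | q 0 ∈ Set.Ioo (a : ℝ) b ∧ 0 < q 1 ∧ q 1 < f (q 0)} →
      (∀ q ∈ s.domain, s.integrand q = 1) →
      ∃ c : KZ.IntegralRep 0, c.domain = Set.univ ∧ (∀ x, c.integrand x = F b - F a) ∧ KZ.Equivalent s c) →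
    (∀ (k : ℕ) (a b : ℚ) (P : Fin k → Fin 3 → Fin 2 → Polynomial ℚ) (r : KZ.IntegralRep 3),
      a < b →
      (∀ i, ∀ t ∈ Set.Ioo (a : ℝ) b,
          (Polynomial.aeval t (P i 1 0) - Polynomial.aeval t (P i 0 0)) *
            (Polynomial.aeval t (P i 2 1) - Polynomial.aeval t (P i 0 1)) -
          (Polynomial.aeval t (P i 1 1) - Polynomial.aeval t (P i 0 1)) *
            (Polynomial.aeval t (P i 2 0) - Polynomial.aeval t (P i 0 0)) ≠ 0) →
      (∀ i i', i ≠ i' → Disjoint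
        {p : Fin 3 → ℝ | p 0 ∈ Set.Ioo (a : ℝ) b ∧ ∃ l m : ℝ, 0 < l ∧ 0 < m ∧ l + m < 1 ∧
            p 1 = Polynomial.aeval (p 0) (P i 0 0) + l * (Polynomial.aeval (p 0) (P i 1 0) - Polynomial.aeval (p 0) (P i 0 0)) +
              m * (Polynomial.aeval (p 0) (P i 2 0) - Polynomial.aeval (p 0) (P i 0 0)) ∧
            p 2 = Polynomial.aeval (p 0) (P i 0 1) + l * (Polynomial.aeval (p 0) (P i 1 1) - Polynomial.aeval (p 0) (P i 0 1)) +
              m * (Polynomial.aeval (p 0) (P i 2 1) - Polynomial.aeval (p 0) (P i 0 1))}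
        {p : Fin 3 → ℝ | p 0 ∈ Set.Ioo (a : ℝ) b ∧ ∃ l m : ℝ, 0 < l ∧ 0 < m ∧ l + m < 1 ∧
            p 1 = Polynomial.aeval (p 0) (P i' 0 0) + l * (Polynomial.aeval (p 0) (P i' 1 0) - Polynomial.aeval (p 0) (P i' 0 0)) +
              m * (Polynomial.aeval (p 0) (P i' 2 0) - Polynomial.aeval (p 0) (P i' 0 0)) ∧
            p 2 = Polynomial.aeval (p 0) (P i' 0 1) + l * (Polynomial.aeval (p 0) (P i' 1 1) - Polynomial.aeval (p 0) (P i' 0 1)) +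
              m * (Polynomial.aeval (p 0) (P i' 2 1) - Polynomial.aeval (p 0) (P i' 0 1))}) →
      r.domain = ⋃ i, {p : Fin 3 → ℝ | p 0 ∈ Set.Ioo (a : ℝ) b ∧ ∃ l m : ℝ, 0 < l ∧ 0 < m ∧ l + m < 1 ∧
            p 1 = Polynomial.aeval (p 0) (P i 0 0) + l * (Polynomial.aeval (p 0) (P i 1 0) - Polynomial.aeval (p 0) (P i 0 0)) +
              m * (Polynomial.aeval (p 0) (P i 2 0) - Polynomial.aeval (p 0) (P i 0 0)) ∧
            p 2 = Polynomial.aeval (p 0) (P i 0 1) + l * (Polynomial.aeval (p 0) (P i 1 1) - Polynomial.aeval (p 0) (P i 0 1)) +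
              m * (Polynomial.aeval (p 0) (P i 2 1) - Polynomial.aeval (p 0) (P i 0 1))} →
      (∀ p ∈ r.domain, r.integrand p = 1) →
      ∃ (Q : Polynomial ℚ) (s : KZ.IntegralRep 2),
        (∀ t ∈ Set.Ioo (a : ℝ) b, 0 ≤ Polynomial.aeval t Q) ∧
        s.domain = {q | q 0 ∈ Set.Ioo (a : ℝ) b ∧ 0 < q 1 ∧ q 1 < Polynomial.aeval (q 0) Q} ∧
        (∀ q ∈ s.domain, s.integrand q = 1) ∧ KZ.Equivalent r s) →
    ∀ (k : ℕ) (a b : ℚ) (P : Fin k → Fin 3 → Fin 2 → Polynomial ℚ) (k' : ℕ) (a' b' : ℚ)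
      (P' : Fin k' → Fin 3 → Fin 2 → Polynomial ℚ) (r r' : KZ.IntegralRep 3),
      a < b →
      (∀ i, ∀ t ∈ Set.Ioo (a : ℝ) b,
          (Polynomial.aeval t (P i 1 0) - Polynomial.aeval t (P i 0 0)) *
          (Polynomial.aeval t (P i 2 1) - Polynomial.aeval t (P i 0 1)) -
        (Polynomial.aeval t (P i 1 1) - Polynomial.aeval t (P i 0 1)) *
          (Polynomial.aeval t (P i 2 0) - Polynomial.aeval t (P i 0 0)) ≠ 0) →
      (∀ i i', i ≠ i' → Disjoint
        {p : Fin 3 → ℝ | p 0 ∈ Set.Ioo (a : ℝ) b ∧ ∃ l m : ℝ, 0 < l ∧ 0 < m ∧ l + m < 1 ∧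
          p 1 = Polynomial.aeval (p 0) (P i 0 0) + l * (Polynomial.aeval (p 0) (P i 1 0) - Polynomial.aeval (p 0) (P i 0 0)) +
            m * (Polynomial.aeval (p 0) (P i 2 0) - Polynomial.aeval (p 0) (P i 0 0)) ∧
          p 2 = Polynomial.aeval (p 0) (P i 0 1) + l * (Polynomial.aeval (p 0) (P i 1 1) - Polynomial.aeval (p 0) (P i 0 1)) +
            m * (Polynomial.aeval (p 0) (P i 2 1) - Polynomial.aeval (p 0) (P i 0 1))}
        {p : Fin 3 → ℝ | p 0 ∈ Set.Ioo (a : ℝ) b ∧ ∃ l m : ℝ, 0 < l ∧ 0 < m ∧ l + m < 1 ∧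
          p 1 = Polynomial.aeval (p 0) (P i' 0 0) + l * (Polynomial.aeval (p 0) (P i' 1 0) - Polynomial.aeval (p 0) (P i' 0 0)) +
            m * (Polynomial.aeval (p 0) (P i' 2 0) - Polynomial.aeval (p 0) (P i' 0 0)) ∧
          p 2 = Polynomial.aeval (p 0) (P i' 0 1) + l * (Polynomial.aeval (p 0) (P i' 1 1) - Polynomial.aeval (p 0) (P i' 0 1)) +
            m * (Polynomial.aeval (p 0) (P i' 2 1) - Polynomial.aeval (p 0) (P i' 0 1))}) →
      r.domain = ⋃ i, {p : Fin 3 → ℝ | p 0 ∈ Set.Ioo (a : ℝ) b ∧ ∃ l m : ℝ, 0 < l ∧ 0 < m ∧ l + m < 1 ∧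
          p 1 = Polynomial.aeval (p 0) (P i 0 0) + l * (Polynomial.aeval (p 0) (P i 1 0) - Polynomial.aeval (p 0) (P i 0 0)) +
            m * (Polynomial.aeval (p 0) (P i 2 0) - Polynomial.aeval (p 0) (P i 0 0)) ∧
          p 2 = Polynomial.aeval (p 0) (P i 0 1) + l * (Polynomial.aeval (p 0) (P i 1 1) - Polynomial.aeval (p 0) (P i 0 1)) +
            m * (Polynomial.aeval (p 0) (P i 2 1) - Polynomial.aeval (p 0) (P i 0 1))} →
      (∀ p ∈ r.domain, r.integrand p = 1) →
      a' < b' →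
      (∀ i, ∀ t ∈ Set.Ioo (a' : ℝ) b',
          (Polynomial.aeval t (P' i 1 0) - Polynomial.aeval t (P' i 0 0)) *
          (Polynomial.aeval t (P' i 2 1) - Polynomial.aeval t (P' i 0 1)) -
        (Polynomial.aeval t (P' i 1 1) - Polynomial.aeval t (P' i 0 1)) *
          (Polynomial.aeval t (P' i 2 0) - Polynomial.aeval t (P' i 0 0)) ≠ 0) →
      (∀ i i', i ≠ i' → Disjoint
        {p : Fin 3 → ℝ | p 0 ∈ Set.Ioo (a' : ℝ) b' ∧ ∃ l m : ℝ, 0 < l ∧ 0 < m ∧ l + m < 1 ∧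
          p 1 = Polynomial.aeval (p 0) (P' i 0 0) + l * (Polynomial.aeval (p 0) (P' i 1 0) - Polynomial.aeval (p 0) (P' i 0 0)) +
            m * (Polynomial.aeval (p 0) (P' i 2 0) - Polynomial.aeval (p 0) (P' i 0 0)) ∧
          p 2 = Polynomial.aeval (p 0) (P' i 0 1) + l * (Polynomial.aeval (p 0) (P' i 1 1) - Polynomial.aeval (p 0) (P' i 0 1)) +
            m * (Polynomial.aeval (p 0) (P' i 2 1) - Polynomial.aeval (p 0) (P' i 0 1))}
        {p : Fin 3 → ℝ | p 0 ∈ Set.Ioo (a' : ℝ) b' ∧ ∃ l m : ℝ, 0 < l ∧ 0 < m ∧ l + m < 1 ∧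
          p 1 = Polynomial.aeval (p 0) (P' i' 0 0) + l * (Polynomial.aeval (p 0) (P' i' 1 0) - Polynomial.aeval (p 0) (P' i' 0 0)) +
            m * (Polynomial.aeval (p 0) (P' i' 2 0) - Polynomial.aeval (p 0) (P' i' 0 0)) ∧
          p 2 = Polynomial.aeval (p 0) (P' i' 0 1) + l * (Polynomial.aeval (p 0) (P' i' 1 1) - Polynomial.aeval (p 0) (P' i' 0 1)) +
            m * (Polynomial.aeval (p 0) (P' i' 2 1) - Polynomial.aeval (p 0) (P' i' 0 1))}) →
      r'.domain = ⋃ i, {p : Fin 3 → ℝ | p 0 ∈ Set.Ioo (a' : ℝ) b' ∧ ∃ l m : ℝ, 0 < l ∧ 0 < m ∧ l + m < 1 ∧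
          p 1 = Polynomial.aeval (p 0) (P' i 0 0) + l * (Polynomial.aeval (p 0) (P' i 1 0) - Polynomial.aeval (p 0) (P' i 0 0)) +
            m * (Polynomial.aeval (p 0) (P' i 2 0) - Polynomial.aeval (p 0) (P' i 0 0)) ∧
          p 2 = Polynomial.aeval (p 0) (P' i 0 1) + l * (Polynomial.aeval (p 0) (P' i 1 1) - Polynomial.aeval (p 0) (P' i 0 1)) +
            m * (Polynomial.aeval (p 0) (P' i 2 1) - Polynomial.aeval (p 0) (P' i 0 1))} →
      (∀ p ∈ r'.domain, r'.integrand p = 1) →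
      r.value = r'.value → KZ.Equivalent r r' := by
  sorry

/-- **The remainder (v2): the frame modulo its planar (= Huber–Wüstholz) layer** (crux-strength; held by
the lead). Modulo `KZ.relations`, every equal-volume pair of BOUNDED integrand-`1` representations of one
dimension is generated by equal-area pairs of PLANAR integrand-`1` representations. Certified
crux-equivalent below (`offPlanarKernel_of_volumeForm`, `VolumeForm_of`); it is `PlanarAreas`-free, the
weakest statement closing the composition, and implied by the v1 remainder (`offPlanarKernel_of_offStackKernel`).
Every strength barrier of the frame (`Literature.Barriers.KontsevichZagierPeriods.kzConjecture_implies_*`)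
applies to it and to nothing else in this file. -/
theorem stub_offPlanarKernel : ∀ ⦃N : ℕ⦄ (r r' : KZ.IntegralRep N),
    Bornology.IsBounded r.domain → Bornology.IsBounded r'.domain →
    (∀ x ∈ r.domain, r.integrand x = 1) → (∀ x ∈ r'.domain, r'.integrand x = 1) →
    r.value = r'.value →
    KZ.of r - KZ.of r' ∈ KZ.relations ⊔ AddSubgroup.closure
      {d : KZ.FormalRep | ∃ (p p' : KZ.IntegralRep 2),
        (∀ x ∈ p.domain, p.integrand x = 1) ∧ (∀ x ∈ p'.domain, p'.integrand x = 1) ∧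
        p.value = p'.value ∧ d = KZ.of p - KZ.of p'} := by
  sorry

/-! ## Vocabulary of the composition (local abbreviations; NOT used in stub signatures) -/

/-- The generators factored out by the remainder: differences of equal-area planar integrand-1 sets. -/
def planarPairs : Set KZ.FormalRep :=
  {d : KZ.FormalRep | ∃ (p p' : KZ.IntegralRep 2),
    (∀ x ∈ p.domain, p.integrand x = 1) ∧ (∀ x ∈ p'.domain, p'.integrand x = 1) ∧
    p.value = p'.value ∧ d = KZ.of p - KZ.of p'}

/-- `S ⊆ ℝ³` is the triangular stack over `(a, b)` with vertex curves `v`. -/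
def IsStackOver (a b : ℝ) (v : Fin 3 → ℝ → Fin 2 → ℝ) (S : Set (Fin 3 → ℝ)) : Prop :=
  a < b ∧
  (∀ j, IsSemialgebraicMapOn ℚ {z : Fin 1 → ℝ | z 0 ∈ Set.Ioo a b} (fun z => v j (z 0))) ∧
  (∀ j, ContDiffOn ℝ 1 (v j) (Set.Ioo a b)) ∧
  (∀ t ∈ Set.Ioo a b, (v 1 t 0 - v 0 t 0) * (v 2 t 1 - v 0 t 1)
    - (v 1 t 1 - v 0 t 1) * (v 2 t 0 - v 0 t 0) ≠ 0) ∧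
  S = {p | p 0 ∈ Set.Ioo a b ∧ ∃ l m : ℝ, 0 < l ∧ 0 < m ∧ l + m < 1 ∧
    p 1 = v 0 (p 0) 0 + l * (v 1 (p 0) 0 - v 0 (p 0) 0) + m * (v 2 (p 0) 0 - v 0 (p 0) 0) ∧
    p 2 = v 0 (p 0) 1 + l * (v 1 (p 0) 1 - v 0 (p 0) 1) + m * (v 2 (p 0) 1 - v 0 (p 0) 1)}

/-- The v1 generators: differences of equal-volume triangular stacks. -/
def stackPairs : Set KZ.FormalRep :=
  {d : KZ.FormalRep | ∃ (s s' : KZ.IntegralRep 3),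
    (∃ (a b : ℝ) (v : Fin 3 → ℝ → Fin 2 → ℝ), IsStackOver a b v s.domain) ∧
    (∃ (a b : ℝ) (v : Fin 3 → ℝ → Fin 2 → ℝ), IsStackOver a b v s'.domain) ∧
    (∀ p ∈ s.domain, s.integrand p = 1) ∧ (∀ p ∈ s'.domain, s'.integrand p = 1) ∧
    s.value = s'.value ∧ d = KZ.of s - KZ.of s'}

/-! ## Sector theorems (landed content of the line, used through `stub_stackSector` / `stub_stackReduction`) -/

/-- Two equal-volume triangular stacks are KZ-equivalent, given the planar layer (landed wave 1). -/
theorem stack_equivalent (hP : PlanarAreas) {s s' : KZ.IntegralRep 3} {a b a' b' : ℝ}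
    {v v' : Fin 3 → ℝ → Fin 2 → ℝ} (hs : IsStackOver a b v s.domain) (hs' : IsStackOver a' b' v' s'.domain)
    (h1 : ∀ p ∈ s.domain, s.integrand p = 1) (h1' : ∀ p ∈ s'.domain, s'.integrand p = 1)
    (hv : s.value = s'.value) : KZ.Equivalent s s' := by
  obtain ⟨hab, hsa, hc, hdet, hdom⟩ := hs
  obtain ⟨hab', hsa', hc', hdet', hdom'⟩ := hs'
  exact stub_stackSector stub_stackReduction hP a b v a' b' v' s s' hab hsa hc hdet hdom h1 hab' hsa' hc'
    hdet' hdom' h1' hv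

/-- A triangular stack differs by relations from an equal-volume PLANAR integrand-1 set (landed
`stub_stackReduction` + soundness): the v1 generators lie in `relations ⊔ closure planarPairs`. -/
theorem stackPairs_subset_sup : stackPairs ⊆ ((KZ.relations ⊔ AddSubgroup.closure planarPairs :
    AddSubgroup KZ.FormalRep) : Set KZ.FormalRep) := by
  rintro d ⟨s, s', ⟨a, b, v, hab, hsa, hc, hdet, hdom⟩, ⟨a', b', v', hab', hsa', hc', hdet', hdom'⟩,
    h1, h1', hv, rfl⟩
  obtain ⟨p, -, hp1, hsp⟩ := stub_stackReduction a b v s hab hsa hc hdet hdom h1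
  obtain ⟨p', -, hp1', hsp'⟩ := stub_stackReduction a' b' v' s' hab' hsa' hc' hdet' hdom' h1'
  have hvp : p.value = p'.value := by
    rw [← KZ.Equivalent.value_eq_holds hsp, ← KZ.Equivalent.value_eq_holds hsp', hv]
  have hgen : KZ.of p - KZ.of p' ∈ AddSubgroup.closure planarPairs :=
    AddSubgroup.subset_closure ⟨p, p', hp1, hp1', hvp, rfl⟩
  have e : KZ.of s - KZ.of s' = (KZ.of s - KZ.of p) - (KZ.of s' - KZ.of p') + (KZ.of p - KZ.of p') := by
    abel
  rw [SetLike.mem_coe, e]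
  exact AddSubgroup.add_mem _ (AddSubgroup.mem_sup_left (KZ.relations.sub_mem hsp hsp'))
    (AddSubgroup.mem_sup_right hgen)

/-- The v1 remainder (generated by stack pairs) implies the v2 remainder (generated by planar pairs). -/
theorem offPlanarKernel_of_offStackKernel
    (h : ∀ ⦃N : ℕ⦄ (r r' : KZ.IntegralRep N),
      Bornology.IsBounded r.domain → Bornology.IsBounded r'.domain →
      (∀ x ∈ r.domain, r.integrand x = 1) → (∀ x ∈ r'.domain, r'.integrand x = 1) →
      r.value = r'.value → KZ.of r - KZ.of r' ∈ KZ.relations ⊔ AddSubgroup.closure stackPairs)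
    ⦃N : ℕ⦄ (r r' : KZ.IntegralRep N) (hb : Bornology.IsBounded r.domain)
    (hb' : Bornology.IsBounded r'.domain) (h1 : ∀ x ∈ r.domain, r.integrand x = 1)
    (h1' : ∀ x ∈ r'.domain, r'.integrand x = 1) (hv : r.value = r'.value) :
    KZ.of r - KZ.of r' ∈ KZ.relations ⊔ AddSubgroup.closure planarPairs := by
  have hle : KZ.relations ⊔ AddSubgroup.closure stackPairs ≤
      KZ.relations ⊔ AddSubgroup.closure planarPairs :=
    sup_le le_sup_left ((AddSubgroup.closure_le _).mpr stackPairs_subset_sup)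
  exact hle (h r r' hb hb' h1 h1' hv)

/-- The four landed one-move calibrations, re-exported as a conjunction (bookkeeping: the line's
"Archimedean flattenings"; the composition below does not need them). -/
theorem archimedeanFlattenings_landed :
    (∀ (r r' : KZ.IntegralRep 3),
      r.domain = {p | p 0 ^ 2 + p 1 ^ 2 + p 2 ^ 2 < 1} →
      r'.domain = {q | q 0 ^ 2 + q 1 ^ 2 < 1 ∧ -(2 / 3 : ℝ) < q 2 ∧ q 2 < 2 / 3} →
      (∀ p ∈ r.domain, r.integrand p = 1) → (∀ q ∈ r'.domain, r'.integrand q = 1) →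
      KZ.of r - KZ.of r' ∈ KZ.changeOfVariablesRel) ∧
    (∀ (r r' : KZ.IntegralRep 3),
      r.domain = {p | p 0 ^ 2 + p 1 ^ 2 < p 2 ^ 2 ∧ 0 < p 2 ∧ p 2 < 1} →
      r'.domain = {q | q 0 ^ 2 + q 1 ^ 2 < 1 ∧ 0 < q 2 ∧ q 2 < 1 / 3} →
      (∀ p ∈ r.domain, r.integrand p = 1) → (∀ q ∈ r'.domain, r'.integrand q = 1) →
      KZ.of r - KZ.of r' ∈ KZ.changeOfVariablesRel) ∧
    (∀ (r r' : KZ.IntegralRep 3),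
      r.domain = {p | p 0 ^ 2 + p 1 ^ 2 + p 2 ^ 2 < 1 ∧ 0 < p 0 ^ 2 + p 1 ^ 2} →
      r'.domain = {q | q 2 ^ 2 < q 0 ^ 2 + q 1 ^ 2 ∧ q 0 ^ 2 + q 1 ^ 2 < 1} →
      (∀ p ∈ r.domain, r.integrand p = 1) → (∀ q ∈ r'.domain, r'.integrand q = 1) →
      KZ.of r - KZ.of r' ∈ KZ.changeOfVariablesRel) :=
  ⟨stub_oddBallCylinder, stub_coneThird, stub_solidHatBox⟩

/-! ## Bookkeeping used by the composition -/

/-- Every generator factored out by the remainder is a relation, given the planar layer. -/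
theorem planarPairs_subset_relations (hP : PlanarAreas) :
    planarPairs ⊆ (KZ.relations : Set KZ.FormalRep) := by
  rintro d ⟨p, p', h1, h1', hv, rfl⟩
  exact hP p p' h1 h1' hv

/-- The remainder's target subgroup collapses to `KZ.relations`, given the planar layer. -/
theorem sup_closure_planarPairs_eq (hP : PlanarAreas) :
    KZ.relations ⊔ AddSubgroup.closure planarPairs = KZ.relations :=
  sup_eq_left.mpr ((AddSubgroup.closure_le _).mpr (planarPairs_subset_relations hP))

/-- **Bounded reduction in every dimension** (tree theorem `KZ.exists_isBounded_sub_mem_relations` for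
`N = m + 1`; trivial for `N = 0`, where every set is bounded). -/
theorem exists_isBounded_sub_mem_relations' {N : ℕ} (r : KZ.IntegralRep N)
    (h1 : ∀ x ∈ r.domain, r.integrand x = 1) :
    ∃ B : KZ.IntegralRep N, Bornology.IsBounded B.domain ∧ (∀ x ∈ B.domain, B.integrand x = 1) ∧
      KZ.of r - KZ.of B ∈ KZ.relations := by
  cases N with
  | zero =>
    refine ⟨r, ?_, h1, by simp [KZ.relations.zero_mem]⟩
    exact (Set.toFinite r.domain).isBounded
  | succ m => exact KZ.exists_isBounded_sub_mem_relations r h1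

/-! ## Certification of the remainder: it is implied by the crux -/

/-- The remainder is not stronger than the crux: `VolumeForm` implies `stub_offPlanarKernel`'s statement
(relations alone suffice). -/
theorem offPlanarKernel_of_volumeForm (hV : VolumeForm) : ∀ ⦃N : ℕ⦄ (r r' : KZ.IntegralRep N),
    Bornology.IsBounded r.domain → Bornology.IsBounded r'.domain →
    (∀ x ∈ r.domain, r.integrand x = 1) → (∀ x ∈ r'.domain, r'.integrand x = 1) →
    r.value = r'.value →
    KZ.of r - KZ.of r' ∈ KZ.relations ⊔ AddSubgroup.closure planarPairs :=
  fun _ r r' _ _ h1 h1' hv => AddSubgroup.mem_sup_left (hV r r' h1 h1' hv)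

/-! ## Composition (sorry-free): the remainder and `PlanarAreas` imply the crux -/

/-- **The line's composition**: `PlanarAreas` (stmt-4990) and `stub_offPlanarKernel` imply the crux
`VolumeForm` (stmt-3814). Reduce `r`, `r'` to bounded `B`, `B'` of the same dimension (tree);
`B.value = B'.value` by soundness; the remainder puts `[B] − [B']` in `relations ⊔ closure planarPairs`,
which is `relations` by `PlanarAreas`. -/
theorem VolumeForm_of (hP : PlanarAreas) : VolumeForm := by
  intro N r r' h1 h1' hv
  obtain ⟨B, hBb, hB1, eB⟩ := exists_isBounded_sub_mem_relations' r h1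
  obtain ⟨B', hBb', hB1', eB'⟩ := exists_isBounded_sub_mem_relations' r' h1'
  have hvB : B.value = B'.value := by
    have e := KZ.relations_le_ker_eval_holds eB
    have e' := KZ.relations_le_ker_eval_holds eB'
    rw [AddMonoidHom.mem_ker, map_sub, KZ.eval_of, KZ.eval_of, sub_eq_zero] at e e'
    rw [← e, ← e', hv]
  have hmem : KZ.of B - KZ.of B' ∈ KZ.relations ⊔ AddSubgroup.closure planarPairs :=
    stub_offPlanarKernel B B' hBb hBb' hB1 hB1' hvB
  rw [sup_closure_planarPairs_eq hP] at hmem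
  have e : KZ.of r - KZ.of r' = (KZ.of r - KZ.of B) - (KZ.of r' - KZ.of B') + (KZ.of B - KZ.of B') := by
    abel
  show KZ.of r - KZ.of r' ∈ KZ.relations
  rw [e]
  exact KZ.relations.add_mem (KZ.relations.sub_mem eB eB') hmem

/-- The same composition for the verbatim copy of the crux in route SphericalSchlafli (r0). -/
theorem VolumeForm_of_sphericalSchlafli (hP : PlanarAreas) :
    Summit.KontsevichZagierPeriods.KontsevichZagierPeriods.Theses.SphericalSchlafli.VolumeForm :=
  fun _ r r' h1 h1' hv => VolumeForm_of hP r r' h1 h1' hv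

/-- The same composition for the verbatim copy of the crux in route WeightFloor (r0). -/
theorem VolumeForm_of_weightFloor (hP : PlanarAreas) :
    Summit.KontsevichZagierPeriods.KontsevichZagierPeriods.Theses.WeightFloor.VolumeForm :=
  fun _ r r' h1 h1' hv => VolumeForm_of hP r r' h1 h1' hv

end Summit.KontsevichZagierPeriods.SymplecticScissors.VolumeForm

end
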